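import Mathlib
import Literature.NumberTheory.GaloisRepresentations.LubinTateComparison
import Literature.NumberTheory.GaloisRepresentations.LubinTateMultiplicativeGroup
import Literature.NumberTheory.GaloisRepresentations.LubinTateComparisonPoints
import Literature.NumberTheory.GaloisRepresentations.LubinTateColemanLogDeriv

/-!
# STUB-IDEAS k1-g38 — «TWISTED RIGIDITY»: the comparison pullback R218a «PULLBACK₂» (= k1-g37 K1 /
# H3′ = k3-g39 T3 `ComparisonChainRule`, «the only open piece» of its split of R218) PROVED — in its
# strongest provable form, and VERBATIM in the docket's currency (§10, 0 sorry)

Route `PrintCf2`, crux `SplitBadTwoLowerHalfOfFacts` (stmt-BirchSwinnertonDyer-27851), stub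
`stub_heegnerIndexLowerAtTwo`, docket item R218 PRIM₂ (STUB-PLAN v7.1 HARDEST (b)), residue H3′
«COMPARISON PULLBACK» of `Ideas/stub-heegnerindexloweratwo-k1-g37.md` (its K1, rank 2).

WEAKEST SUFFICIENT FORM (what `mahler_transport` of k1-g37 §10 consumes): `hcomp :
(1 + X) * d⁄dX (λ′ ∘ ϑ) = C ε` — §7 `hcomp_of_log_pullback` (verbatim shape) / `hcomp_of_pullback`.
STRONGEST PROVABLE FORM (this file): for ANY commutative ring `A` with an endomorphism `φ`, ANY
`f ≡ πX (mod deg 2)`, and ANY series `D` with a twisted linear recursion `(D^φ ∘ f)·M₁ = D·M₂`, `D`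
vanishes as soon as its first `n₀` coefficients do and `μ₂x = μ₁πⁿφ(x) ⇒ x = 0` for `n ≥ n₀`
(§2 `twisted_rigidity`) — no formal group law, no Lubin–Tate congruence `f ≡ X^q (mod π)`, no
homomorphism property / existence / uniqueness of `ϑ`, no field, no norm.  Consequences (0 sorry):
* §3 `hsep_of_isAdicComplete` — the separatedness hypothesis from `IsAdicComplete (span {π}) A` +
  `φ π = π` (tree `LubinTate.eq_zero_of_eq_mul_map`), i.e. exactly the setting of `LubinTate.compSeries`;
* §4 `invDiff_pullback` — **`ϖ_f · ϑ′ = ε · ϖ_{f′}(ϑ)`** for every intertwiner `ϑ^φ ∘ f = f′ ∘ ϑ`,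
  `ϑ ≡ εX`, `φ ε = u ε`, where `ϖ` is the tree's `invDiff` currency (`ϖ · [a]′ = a · ϖ ∘ [a]`,
  `LubinTate.invDiff_mul_derivative_hom` / `invDiff_mul_derivative_ltSer`): the invariant derivations
  `D_f = ϖ_f d/dX`, `D_{f′}` correspond under `ϑ` up to the period `ε` (de Shalit's `Ω`);
* §5 `log_pullback` — **`λ_{f′} ∘ ϑ = ε · λ_f`** over any ring carrying the logarithms;
* §6 the frame at `v ∣ 2` split, `f = (1 + X)² − 1 = [2]_{𝔾̂_m}` (tree
  `LubinTate.isLTSeries_one_add_X_pow_sub_one 2`), `ϖ_f = 1 + X` (`invDiff_eq_frame`, proved):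
  `frame_pullback_two` **`(1 + X) · ϑ′ = ε · ϖ′(ϑ)`**; §6b at log level over a `ℚ`-algebra with
  Mathlib's `PowerSeries.log` (`log_subst_frame : log((1+X)²) = 2 log(1+X)` proved):
  `frame_log_pullback_two` **`λ′ ∘ ϑ = ε · log(1 + X)`**;
* §7 `hcomp_of_log_pullback` : **`(1 + X) · (λ′ ∘ ϑ)′ = C ε`** — literally `hcomp` of k1-g37's
  `mahler_transport` (`Ω = ε`); `hcomp_of_pullback`: the same from §6 in any algebra with `λ′′ · ϖ′ = 1`;
* §8 `invDiff_pullback_compSeries` / `frame_pullback_compSeries` — the instantiation on the tree's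
  comparison series `ϑ = LubinTate.compSeries ι φ hA hf hf' hε` (`subst_compSeries`,
  `coeff_one_compSeries`, `constantCoeff_compSeries`, `IsTwistBase.eq_zero_of_mul_eq_zero`, `.map_eq`),
  with only `ϖ′` (the `invDiff` of `f′` read in `A`) left abstract through its defining identity;
* §9 the H2 currency bridge `‖p⁻¹x‖ ≤ 1 ↔ x ∈ p·(unit ball)` (k1-g37 K2, XS).
* §10 ★★★★ `comparisonChainRuleC` / `comparisonChainRule_two` — **k3-g39's sub-stub T3
  `ComparisonChainRule h2 u hσ₀ hε` (body verbatim), for EVERY uniformiser `π` and every `q`**: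
  `ω_f^ι · ϑ′ = C (coeff 1 ϑ) · ω_{f′}^ι(ϑ)` in `UnrCoeff F⟦X⟧` for `ϑ = compSeriesC hπ hσ₀ u hε`,
  `ω = LubinTate.invDiff (isLTRing_LTCoeff _) (isLTSeries_LTCoeff _)`; and over `𝒪̂_{F^nr}` itself
  `invDiff_mul_derivative_ltComparison` for `ϑ = ltComparison hπ hσ₀ u hε`.  The six side conditions of §8
  are discharged BY NAME (`constantCoeff_invDiff`, `maxUnramifiedCompletion.galAut_algebraMap`,
  `invDiff_mul_derivative_ltSer`, `isTwistBase_galAut`, `isAdicComplete_span_unrPi`, `isLTSeries_ltPoly`).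
  R218a (CRITIC-ROWS-g39 row 113 (π1), S⁻) is thereby KERNEL, and with it k3-g39's
  `boundedPrimitive_of_comparisonChainRule` has no open hypothesis left.

AUTOPSY (B65-class orientation slip, `autopsy_K1_as_typed{_coeff_one}`): k1-g37 typed H3′ as
`(1 + X) * ((invDiff′).subst ϑ * ϑ′) = C ε`; with the tree's `invDiff = ϖ = 1/λ′` (docstring of
`LubinTate.invDiff`; `ϖ·[a]′ = a·ϖ∘[a]`) that statement together with the proved §6 forces
`2 · ϖ′₁ · ε² = 0`, false in the frame (`ε ∈ 𝒪̂ˣ_{ℚ₂^nr}`, `ϖ′₁ = 2/(π′² − π′) ≠ 0` for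
`f′ = π′X + X²`): the correct `invDiff`-currency statement has `ϖ′(ϑ)` on the RIGHT (§6), the correct
`λ`-currency statement is `hcomp` (§7).  Nothing here proves BSD.
-/

noncomputable section

open PowerSeries

namespace Summit.BirchSwinnertonDyer.BirchSwinnertonDyer.Cruxes.SplitBadTwoLowerHalfOfFacts.TwistedRigidityK1G38

variable {A : Type*} [CommRing A]

/-! ### §1 Helpers: constant terms through `subst`, `d⁄dX` -/

/-- `G(f)(0) = G(0)` when `f(0) = 0`. -/
theorem constantCoeff_subst_of_constantCoeff_eq_zero {f : A⟦X⟧} (hf : constantCoeff f = 0)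
    (G : A⟦X⟧) : constantCoeff (G.subst f) = constantCoeff G := by
  have hs : HasSubst f := HasSubst.of_constantCoeff_zero' hf
  have h := PowerSeries.constantCoeff_subst hs G
  rw [finsum_eq_single _ 0 (fun d hd => by
    rw [map_pow, show MvPowerSeries.constantCoeff f = constantCoeff f from rfl, hf, zero_pow hd,
      smul_zero])] at h
  rw [pow_zero, map_one, coeff_zero_eq_constantCoeff, smul_eq_mul, mul_one] at h
  exact h

/-- `(d⁄dX G)(0) = G₁`. -/
theorem constantCoeff_derivative' (G : A⟦X⟧) : constantCoeff (d⁄dX A G) = coeff 1 G := by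
  rw [← coeff_zero_eq_constantCoeff_apply, coeff_derivative, Nat.cast_zero, zero_add, zero_add, mul_one]

/-- `(G^φ)(0) = φ(G(0))`. -/
theorem constantCoeff_map' {T : Type*} [CommRing T] (φ : A →+* T) (G : A⟦X⟧) :
    constantCoeff (G.map φ) = φ (constantCoeff G) := by
  rw [← coeff_zero_eq_constantCoeff_apply, coeff_map, coeff_zero_eq_constantCoeff_apply]

/-- `d⁄dX` commutes with coefficientwise maps. -/
theorem derivative_map' {T : Type*} [CommRing T] (φ : A →+* T) (G : A⟦X⟧) :
    d⁄dX T (G.map φ) = (d⁄dX A G).map φ := by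
  ext n
  simp only [coeff_derivative, coeff_map, map_mul, map_add, map_natCast, map_one]

/-- `subst` is multiplicative (spelling without `substAlgHom`). -/
theorem subst_mul' {a : A⟦X⟧} (ha : HasSubst a) (G H : A⟦X⟧) :
    (G * H).subst a = G.subst a * H.subst a := by
  rw [← coe_substAlgHom ha, map_mul]

/-- One-variable spelling of `PowerSeries.map_subst`: `(G ∘ Ψ)^h = G^h ∘ Ψ^h`. -/
theorem map_subst_one' {T : Type*} [CommRing T] (h : A →+* T) {Ψ : A⟦X⟧} (hs : HasSubst Ψ)
    (G : A⟦X⟧) : PowerSeries.map h (G.subst Ψ) = (G.map h).subst (Ψ.map h) :=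
  PowerSeries.map_subst hs G

/-- `(C r) ∘ a = C r` (one-variable spelling of `PowerSeries.subst_C`). -/
theorem subst_C' (a : A⟦X⟧) (r : A) : (C r : A⟦X⟧).subst a = C r := by
  rw [PowerSeries.subst_C]
  rfl

/-- `(G ∘ ϑ)₁ = G₁ · ϑ₁` when `ϑ(0) = 0`. -/
theorem coeff_one_subst_of_constantCoeff_eq_zero {ϑ : A⟦X⟧} (hϑ : constantCoeff ϑ = 0) (G : A⟦X⟧) :
    coeff 1 (G.subst ϑ) = coeff 1 G * coeff 1 ϑ := by
  have hs : HasSubst ϑ := HasSubst.of_constantCoeff_zero' hϑ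
  rw [← constantCoeff_derivative', derivative_subst A hs, map_mul,
    constantCoeff_subst_of_constantCoeff_eq_zero hϑ, constantCoeff_derivative', constantCoeff_derivative']

/-- `f = X · g` with `g(0) = f₁` when `f(0) = 0`. -/
theorem exists_eq_X_mul_of_constantCoeff_eq_zero {f : A⟦X⟧} (hf : constantCoeff f = 0) :
    ∃ g : A⟦X⟧, f = X * g ∧ constantCoeff g = coeff 1 f := by
  obtain ⟨g, hg⟩ := X_dvd_iff.mpr hf
  refine ⟨g, hg, ?_⟩
  rw [hg, ← pow_one (X : A⟦X⟧), show (1 : ℕ) = 0 + 1 from rfl, coeff_X_pow_mul,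
    coeff_zero_eq_constantCoeff_apply]

/-! ### §2 Twisted rigidity (the strongest provable form)

If `(D^φ ∘ f) · M₁ = D · M₂` with `f ≡ πX (mod deg 2)`, `f(0) = 0`, the first `n₀` coefficients of `D`
vanish, and `μ₂ x = μ₁ πⁿ φ(x) ⟹ x = 0` for all `n ≥ n₀` (`μᵢ = Mᵢ(0)`), then `D = 0`: comparing the
lowest coefficient `d_n` of both sides gives exactly `μ₂ d_n = μ₁ πⁿ φ(d_n)`. -/

/-- **Twisted rigidity.** -/
theorem twisted_rigidity (φ : A →+* A) {π : A} {f : A⟦X⟧} (hf0 : constantCoeff f = 0)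
    (hf1 : coeff 1 f = π) {M₁ M₂ D : A⟦X⟧} {n₀ : ℕ} (hD : ∀ k, k < n₀ → coeff k D = 0)
    (hsep : ∀ n, n₀ ≤ n → ∀ x : A,
      constantCoeff M₂ * x = constantCoeff M₁ * π ^ n * φ x → x = 0)
    (heq : (D.map φ).subst f * M₁ = D * M₂) : D = 0 := by
  have hs : HasSubst f := HasSubst.of_constantCoeff_zero' hf0
  obtain ⟨g, hg, hg0⟩ := exists_eq_X_mul_of_constantCoeff_eq_zero hf0
  rw [hf1] at hg0
  have key : ∀ N, n₀ ≤ N → ∀ k, k < N → coeff k D = 0 := by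
    intro N hN
    induction N, hN using Nat.le_induction with
    | base => exact hD
    | succ N hN ih =>
      obtain ⟨E, hE⟩ := (X_pow_dvd_iff (φ := D)).mpr ih
      have hND : coeff N D = constantCoeff E := by
        have h := coeff_X_pow_mul E N 0
        rw [zero_add, coeff_zero_eq_constantCoeff_apply] at h
        rw [hE, h]
      have lhs : (D.map φ).subst f * M₁ = X ^ N * (g ^ N * (E.map φ).subst f * M₁) := by
        rw [hE, map_mul, map_pow, map_X, ← coe_substAlgHom hs, map_mul, map_pow, coe_substAlgHom,
          subst_X hs, hg, mul_pow]
        ring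
      have rhs : D * M₂ = X ^ N * (E * M₂) := by rw [hE, mul_assoc]
      have h1 := congrArg (coeff (0 + N)) heq
      rw [lhs, rhs, coeff_X_pow_mul, coeff_X_pow_mul, coeff_zero_eq_constantCoeff_apply,
        coeff_zero_eq_constantCoeff_apply, map_mul, map_mul, map_mul, map_pow, hg0,
        constantCoeff_subst_of_constantCoeff_eq_zero hf0, constantCoeff_map'] at h1
      have he : constantCoeff E = 0 :=
        hsep N hN (constantCoeff E) (by linear_combination -h1)
      intro k hk
      rcases Nat.lt_succ_iff_lt_or_eq.mp hk with hk | rfl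
      · exact ih k hk
      · rw [hND, he]
  ext k
  rw [map_zero]
  exact key (max (k + 1) n₀) (le_max_right _ _) k
    (lt_of_lt_of_le (Nat.lt_succ_self k) (le_max_left _ _))

/-! ### §3 Discharging the separatedness hypothesis

In a `(π)`-adically complete and separated ring with `φ π = π` (the tree's setting of
`LubinTate.compSeries`: `IsAdicComplete (Ideal.span {ι π₀}) A`, `IsTwistBase.map_eq`,
`IsTwistBase.eq_zero_of_mul_eq_zero`), `u x = πⁿ φ(x)` with `u` a unit and `n ≥ 1` forces `x = 0`
(tree `LubinTate.eq_zero_of_eq_mul_map`). -/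

/-- Cancel a power of a non-zero-divisor. -/
theorem eq_zero_of_pow_mul_eq_zero {π : A} (hreg : ∀ x : A, π * x = 0 → x = 0) (m : ℕ) {x : A}
    (h : π ^ m * x = 0) : x = 0 := by
  induction m generalizing x with
  | zero => simpa using h
  | succ m ih =>
    rw [pow_succ, mul_assoc] at h
    exact hreg _ (ih h)

/-- **`hsep` from adic completeness** (`u` a unit, `φ π = π`, `n ≥ 1`). -/
theorem hsep_of_isAdicComplete {π : A} [IsAdicComplete (Ideal.span {π}) A] (φ : A →+* A)
    (hφ : φ π = π) (u : Aˣ) {n : ℕ} (hn : 1 ≤ n) {x : A} (h : (u : A) * x = π ^ n * φ x) :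
    x = 0 := by
  obtain ⟨k, rfl⟩ := Nat.exists_eq_add_of_le' hn
  refine Literature.NumberTheory.GaloisRepresentations.LubinTate.eq_zero_of_eq_mul_map π φ hφ
    (lam := ((u⁻¹ : Aˣ) : A) * π ^ (k + 1)) (Dvd.intro_left (((u⁻¹ : Aˣ) : A) * π ^ k) (by ring)) ?_
  have hu : ((u⁻¹ : Aˣ) : A) * (u : A) = 1 := Units.inv_mul u
  linear_combination ((u⁻¹ : Aˣ) : A) * h - x * hu

/-! ### §4 The invariant derivations correspond under `ϑ` up to `ε` (tree `invDiff` currency)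

`ϖ` below is the tree's `invDiff` (`ω_F(Y) = ∂F/∂X(0,Y) = 1/λ′`), characterised by `ϖ · f′ = π · ϖ ∘ f`
(`LubinTate.invDiff_mul_derivative_hom` with `a = π`, `LubinTate.invDiff_mul_derivative_ltSer`);
`ϑ` is ANY series with `ϑ ≡ εX (mod deg 2)` and `ϑ^φ ∘ f = f′ ∘ ϑ` (`LubinTate.subst_compSeries`,
`coeff_one_compSeries`, `constantCoeff_compSeries`).  No formal group law is used. -/

/-- ★ **Twisted pullback of the invariant derivation**: `ϖ_f · ϑ′ = ε · ϖ_{f′}(ϑ)`. -/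
theorem invDiff_pullback (φ : A →+* A) {π u ε : A} {f f' ϖ ϖ' ϑ : A⟦X⟧}
    (hf0 : constantCoeff f = 0) (hf1 : coeff 1 f = π)
    (hf'0 : constantCoeff f' = 0) (hf'1 : coeff 1 f' = u * π)
    (hϖ0 : constantCoeff ϖ = 1) (hϖφ : ϖ.map φ = ϖ) (hEf : ϖ * d⁄dX A f = C π * ϖ.subst f)
    (hϖ'0 : constantCoeff ϖ' = 1) (hϖ'φ : ϖ'.map φ = ϖ')
    (hEf' : ϖ' * d⁄dX A f' = C (u * π) * ϖ'.subst f')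
    (hϑ0 : constantCoeff ϑ = 0) (hϑ1 : coeff 1 ϑ = ε) (hε : φ ε = u * ε)
    (hϑ : (ϑ.map φ).subst f = f'.subst ϑ)
    (hreg : ∀ x : A, π * x = 0 → x = 0)
    (hsep : ∀ n, 1 ≤ n → ∀ x : A, u * x = π ^ n * φ x → x = 0) :
    ϖ * d⁄dX A ϑ = C ε * ϖ'.subst ϑ := by
  have hs : HasSubst f := HasSubst.of_constantCoeff_zero' hf0
  have hs' : HasSubst f' := HasSubst.of_constantCoeff_zero' hf'0
  have hsϑ : HasSubst ϑ := HasSubst.of_constantCoeff_zero' hϑ0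
  have hϑφ0 : constantCoeff (ϑ.map φ) = 0 := by rw [constantCoeff_map', hϑ0, map_zero]
  have hsϑφ : HasSubst (ϑ.map φ) := HasSubst.of_constantCoeff_zero' hϑφ0
  rw [← sub_eq_zero]
  set D : A⟦X⟧ := ϖ * d⁄dX A ϑ - C ε * ϖ'.subst ϑ with hD_def
  refine twisted_rigidity φ hf0 hf1 (M₁ := C π * d⁄dX A f)
    (M₂ := d⁄dX A f * (d⁄dX A f').subst ϑ) (n₀ := 1) (D := D) (fun k hk => ?_)
    (fun n hn x hx => ?_) ?_
  · obtain rfl : k = 0 := by omega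
    rw [coeff_zero_eq_constantCoeff_apply, hD_def, map_sub, map_mul, map_mul, hϖ0,
      constantCoeff_derivative', hϑ1, constantCoeff_C,
      constantCoeff_subst_of_constantCoeff_eq_zero hϑ0, hϖ'0]
    ring
  · rw [map_mul, map_mul, constantCoeff_C, constantCoeff_derivative', hf1,
      constantCoeff_subst_of_constantCoeff_eq_zero hϑ0, constantCoeff_derivative', hf'1] at hx
    have h2 := eq_zero_of_pow_mul_eq_zero hreg 2 (x := u * x - π ^ n * φ x)
      (by linear_combination hx)
    exact hsep n hn x (sub_eq_zero.mp h2)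
  · -- the three functional identities, all read in `A⟦X⟧`
    -- (a) `C π · ϖ(f) = ϖ · f′`                                  [hEf]
    -- (b) `(ϑ^φ)′(f) · f′ = (f′)′(ϑ) · ϑ′`                        [chain rule on hϑ]
    -- (c) `C (uπ) · (ϖ′ ∘ f′)(ϑ) = ϖ′(ϑ) · (f′)′(ϑ)`              [hEf′ read at ϑ]
    have hb : (d⁄dX A (ϑ.map φ)).subst f * d⁄dX A f =
        (d⁄dX A f').subst ϑ * d⁄dX A ϑ := by
      rw [← derivative_subst A hs, hϑ, derivative_subst A hsϑ]
    have hc : C (u * π) * PowerSeries.subst ϑ (ϖ'.subst f') =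
        ϖ'.subst ϑ * (d⁄dX A f').subst ϑ := by
      have h : (ϖ' * d⁄dX A f').subst ϑ =
          PowerSeries.subst ϑ (C (u * π) * ϖ'.subst f' : A⟦X⟧) := by
        rw [hEf']
      rw [subst_mul' hsϑ, subst_mul' hsϑ, subst_C'] at h
      exact h.symm
    have hDφ : (D.map φ).subst f =
        ϖ.subst f * (d⁄dX A (ϑ.map φ)).subst f -
          C (u * ε) * PowerSeries.subst ϑ (ϖ'.subst f') := by
      rw [hD_def, map_sub, map_mul, map_mul, hϖφ, ← derivative_map', map_C, hε,
        map_subst_one' φ hsϑ, hϖ'φ, PowerSeries.subst_sub hs, subst_mul' hs, subst_mul' hs,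
        subst_C', PowerSeries.subst_comp_subst_apply hsϑφ hs, hϑ,
        ← PowerSeries.subst_comp_subst_apply hs' hsϑ]
    rw [hDφ, hD_def]
    simp only [map_mul] at hc ⊢
    linear_combination ((d⁄dX A (ϑ.map φ)).subst f * d⁄dX A f) * hEf.symm
      + (ϖ * d⁄dX A f) * hb - (C ε * d⁄dX A f) * hc

/-! ### §5 `ϑ` intertwines the logarithms: `λ_{f′} ∘ ϑ = ε · λ_f`

Over any ring `A` carrying the logarithms (`λ ∘ f = π λ`, `λ′ ∘ f′ = π′ λ′`, `λ ≡ λ′ ≡ X (mod deg 2)`;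
tree `ltLog`, `subst_ltPolyF_ltLog`, `eq_ltLog` over the field `F`), with the separatedness hypothesis
now starting at `n = 2`. -/

/-- ★ **`λ_{f′} ∘ ϑ = ε · λ_f`.** -/
theorem log_pullback (φ : A →+* A) {π u ε : A} {f f' lam lam' ϑ : A⟦X⟧}
    (hf0 : constantCoeff f = 0) (hf1 : coeff 1 f = π) (hf'0 : constantCoeff f' = 0)
    (hlam0 : constantCoeff lam = 0) (hlam1 : coeff 1 lam = 1) (hlamφ : lam.map φ = lam)
    (hlamf : lam.subst f = C π * lam)
    (hlam'0 : constantCoeff lam' = 0) (hlam'1 : coeff 1 lam' = 1) (hlam'φ : lam'.map φ = lam')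
    (hlam'f : lam'.subst f' = C (u * π) * lam')
    (hϑ0 : constantCoeff ϑ = 0) (hϑ1 : coeff 1 ϑ = ε) (hε : φ ε = u * ε)
    (hϑ : (ϑ.map φ).subst f = f'.subst ϑ)
    (hsep : ∀ n, 2 ≤ n → ∀ x : A, u * π * x = π ^ n * φ x → x = 0) :
    lam'.subst ϑ = C ε * lam := by
  have hs : HasSubst f := HasSubst.of_constantCoeff_zero' hf0
  have hs' : HasSubst f' := HasSubst.of_constantCoeff_zero' hf'0
  have hsϑ : HasSubst ϑ := HasSubst.of_constantCoeff_zero' hϑ0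
  have hϑφ0 : constantCoeff (ϑ.map φ) = 0 := by rw [constantCoeff_map', hϑ0, map_zero]
  have hsϑφ : HasSubst (ϑ.map φ) := HasSubst.of_constantCoeff_zero' hϑφ0
  rw [← sub_eq_zero]
  set D : A⟦X⟧ := lam'.subst ϑ - C ε * lam with hD_def
  refine twisted_rigidity φ hf0 hf1 (M₁ := 1) (M₂ := C (u * π)) (n₀ := 2) (D := D)
    (fun k hk => ?_) (fun n hn x hx => ?_) ?_
  · interval_cases k
    · rw [coeff_zero_eq_constantCoeff_apply, hD_def, map_sub, map_mul,
        constantCoeff_subst_of_constantCoeff_eq_zero hϑ0, hlam'0, hlam0, mul_zero, sub_zero]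
    · rw [hD_def, map_sub, coeff_one_subst_of_constantCoeff_eq_zero hϑ0, hlam'1, hϑ1,
        coeff_C_mul, hlam1]
      ring
  · rw [map_one, constantCoeff_C, one_mul] at hx
    exact hsep n hn x hx
  · have hDφ : (D.map φ).subst f =
        PowerSeries.subst ϑ (lam'.subst f') - C (u * ε) * (C π * lam) := by
      rw [hD_def, map_sub, map_mul, map_C, hε, map_subst_one' φ hsϑ, hlam'φ,
        PowerSeries.subst_sub hs, subst_mul' hs, subst_C',
        PowerSeries.subst_comp_subst_apply hsϑφ hs, hϑ,
        ← PowerSeries.subst_comp_subst_apply hs' hsϑ, hlamφ, hlamf]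
    rw [hDφ, hlam'f, subst_mul' hsϑ, subst_C', hD_def]
    simp only [map_mul, mul_one]
    ring

/-! ### §6 The frame at `v ∣ 2` split: `𝔾̂_m = F_{2X + X²}`, `ϖ_{𝔾̂_m} = 1 + X`

For `F = ℚ₂`, `q = 2`, `π₀ = 2`: `f = 2X + X² = (1+X)² − 1 = [2]_{𝔾̂_m}` (tree `ltPoly`/`ltSer` at `π = 2`,
`LubinTateMultiplicativeBase`), and `ϖ = 1 + X` satisfies `ϖ · f′ = 2 · ϖ ∘ f` by direct computation,
so §4 specialises with NO appeal to the identification `F_f = 𝔾̂_m`. -/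

/-- `f(0) = 0` for the frame series `f = (1 + X)² − 1`. -/
theorem frame_constantCoeff : constantCoeff ((1 + X : A⟦X⟧) ^ 2 - 1) = 0 := by simp

/-- `f ≡ 2X (mod deg 2)`. -/
theorem frame_coeff_one : coeff 1 ((1 + X : A⟦X⟧) ^ 2 - 1) = 2 := by
  rw [Literature.NumberTheory.GaloisRepresentations.LubinTate.coeff_one_add_X_pow_sub_one]
  norm_num

theorem frame_hasSubst : HasSubst ((1 + X : A⟦X⟧) ^ 2 - 1) :=
  HasSubst.of_constantCoeff_zero' frame_constantCoeff

/-- `(1 + X) ∘ f = (1 + X)²`. -/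
theorem subst_one_add_X_frame :
    (1 + X : A⟦X⟧).subst ((1 + X : A⟦X⟧) ^ 2 - 1) = (1 + X) ^ 2 := by
  rw [← coe_substAlgHom frame_hasSubst, map_add, map_one, coe_substAlgHom,
    subst_X frame_hasSubst]
  ring

/-- `f′ = 2(1 + X)`. -/
theorem deriv_frame : d⁄dX A ((1 + X : A⟦X⟧) ^ 2 - 1) = 2 * (1 + X) := by
  rw [sq, show (1 + X : A⟦X⟧) * (1 + X) - 1 = X + X + X * X by ring, map_add, map_add,
    (d⁄dX A).leibniz, derivative_X, smul_eq_mul]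
  ring

/-- `(1 + X) · f′ = 2 · (1 + X) ∘ f` (both are `2(1+X)²`): `ϖ_{𝔾̂_m} = 1 + X` satisfies the
`[2]`-equivariance `hEf` of §4 for `f = (1 + X)² − 1`. -/
theorem invDiff_eq_frame :
    (1 + X : A⟦X⟧) * d⁄dX A ((1 + X : A⟦X⟧) ^ 2 - 1) =
      C 2 * (1 + X : A⟦X⟧).subst ((1 + X : A⟦X⟧) ^ 2 - 1) := by
  rw [subst_one_add_X_frame, deriv_frame, map_ofNat]
  ring

/-- ★★ **The frame pullback (corrected K1/H3′ in `invDiff` currency)**, `f = (1 + X)² − 1 = [2]_{𝔾̂_m}`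
(tree `LubinTate.isLTSeries_one_add_X_pow_sub_one 2`):
`(1 + X) · ϑ′ = ε · ϖ′(ϑ)` for every intertwiner `ϑ^φ ∘ f = f′ ∘ ϑ` with `ϑ ≡ εX`, `φ ε = u ε`. -/
theorem frame_pullback_two (φ : A →+* A) {u ε : A} {f' ϖ' ϑ : A⟦X⟧}
    (hf'0 : constantCoeff f' = 0) (hf'1 : coeff 1 f' = u * 2)
    (hϖ'0 : constantCoeff ϖ' = 1) (hϖ'φ : ϖ'.map φ = ϖ')
    (hEf' : ϖ' * d⁄dX A f' = C (u * 2) * ϖ'.subst f')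
    (hϑ0 : constantCoeff ϑ = 0) (hϑ1 : coeff 1 ϑ = ε) (hε : φ ε = u * ε)
    (hϑ : (ϑ.map φ).subst ((1 + X : A⟦X⟧) ^ 2 - 1) = f'.subst ϑ)
    (hreg : ∀ x : A, 2 * x = 0 → x = 0)
    (hsep : ∀ n, 1 ≤ n → ∀ x : A, u * x = 2 ^ n * φ x → x = 0) :
    (1 + X : A⟦X⟧) * d⁄dX A ϑ = C ε * ϖ'.subst ϑ :=
  invDiff_pullback φ (f := (1 + X : A⟦X⟧) ^ 2 - 1) (ϖ := 1 + X) frame_constantCoeff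
    frame_coeff_one hf'0 hf'1 (by simp) (by rw [map_add, map_one, map_X]) invDiff_eq_frame hϖ'0 hϖ'φ
    hEf' hϑ0 hϑ1 hε hϑ hreg hsep

/-! ### §6b The frame at the level of logarithms: `λ_{𝔾̂_m} = log(1 + X)` (Mathlib `PowerSeries.log`)

Over a `ℚ`-algebra `E` (the fields `K̂^{nr} ⊂ ℂ₂` of the docket) the logarithm of `F_f = 𝔾̂_m` is
`log(1 + X)`; its `[2]`-functional equation `log((1+X)²) = 2·log(1+X)` is proved here from
`(1 + X)·log′ = 1` and `PowerSeries.derivative.ext`, so §5 specialises with no hypothesis on `𝔾̂_m` left. -/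

/-- `(1 + X) · (log(1+X))′ = 1`. -/
theorem one_add_X_mul_deriv_log [Algebra ℚ A] : (1 + X : A⟦X⟧) * d⁄dX A (log A) = 1 := by
  ext n
  rw [deriv_log, add_mul, one_mul, map_add, coeff_one]
  rcases n with _ | n
  · simp
  · rw [coeff_succ_X_mul, coeff_mk, coeff_mk, if_neg n.succ_ne_zero, ← map_add, pow_succ]
    simp

/-- **`log((1 + X)²) = 2 · log(1 + X)`**: the `[2]_{𝔾̂_m}`-functional equation of `λ_{𝔾̂_m}`. -/
theorem log_subst_frame [Algebra ℚ A] [IsAddTorsionFree A] :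
    (log A).subst ((1 + X : A⟦X⟧) ^ 2 - 1) = C 2 * log A := by
  have hs : HasSubst ((1 + X : A⟦X⟧) ^ 2 - 1) := frame_hasSubst
  have hG : (1 + X : A⟦X⟧) ^ 2 * (d⁄dX A (log A)).subst ((1 + X : A⟦X⟧) ^ 2 - 1) = 1 := by
    have h : ((1 + X : A⟦X⟧) * d⁄dX A (log A)).subst ((1 + X : A⟦X⟧) ^ 2 - 1) =
        (1 : A⟦X⟧).subst ((1 + X : A⟦X⟧) ^ 2 - 1) := by rw [one_add_X_mul_deriv_log]
    have h1 : (1 : A⟦X⟧).subst ((1 + X : A⟦X⟧) ^ 2 - 1) = 1 := by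
      rw [← coe_substAlgHom hs, map_one]
    rwa [subst_mul' hs, subst_one_add_X_frame, h1] at h
  have hu : IsUnit ((1 + X : A⟦X⟧) ^ 2) := by
    refine IsUnit.pow 2 ?_
    rw [PowerSeries.isUnit_iff_constantCoeff]
    simp
  refine derivative.ext (hu.mul_left_cancel ?_) ?_
  · rw [derivative_subst A hs, deriv_frame, (d⁄dX A).leibniz (C (2 : A)) (log A), derivative_C,
      smul_zero, add_zero, smul_eq_mul,
      show (1 + X : A⟦X⟧) ^ 2 * ((d⁄dX A (log A)).subst ((1 + X : A⟦X⟧) ^ 2 - 1) * (2 * (1 + X)))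
        = ((1 + X : A⟦X⟧) ^ 2 * (d⁄dX A (log A)).subst ((1 + X : A⟦X⟧) ^ 2 - 1)) * (2 * (1 + X))
        by ring, hG,
      show (1 + X : A⟦X⟧) ^ 2 * (C (2 : A) * d⁄dX A (log A))
        = C 2 * (1 + X) * ((1 + X) * d⁄dX A (log A)) by ring, one_add_X_mul_deriv_log, map_ofNat]
    ring
  · rw [constantCoeff_subst_of_constantCoeff_eq_zero frame_constantCoeff, map_mul, constantCoeff_log,
      mul_zero]

/-- ★★ **The frame pullback at log level**: `λ′ ∘ ϑ = ε · log(1 + X)` for every intertwiner `ϑ`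
(`ϑ^φ ∘ ((1+X)² − 1) = f′ ∘ ϑ`, `ϑ ≡ εX`, `φ ε = u ε`) and every `φ`-fixed normalised solution `λ′` of
`λ′ ∘ f′ = 2u · λ′` (tree: `LubinTate.ltLog`, `subst_ltPolyF_ltLog`, coefficients in `F`). -/
theorem frame_log_pullback_two [Algebra ℚ A] [IsAddTorsionFree A] (φ : A →+* A) {u ε : A}
    {f' lam' ϑ : A⟦X⟧} (hf'0 : constantCoeff f' = 0)
    (hlam'0 : constantCoeff lam' = 0) (hlam'1 : coeff 1 lam' = 1) (hlam'φ : lam'.map φ = lam')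
    (hlam'f : lam'.subst f' = C (u * 2) * lam')
    (hϑ0 : constantCoeff ϑ = 0) (hϑ1 : coeff 1 ϑ = ε) (hε : φ ε = u * ε)
    (hϑ : (ϑ.map φ).subst ((1 + X : A⟦X⟧) ^ 2 - 1) = f'.subst ϑ)
    (hsep : ∀ n, 2 ≤ n → ∀ x : A, u * 2 * x = 2 ^ n * φ x → x = 0) :
    lam'.subst ϑ = C ε * log A :=
  log_pullback φ (f := (1 + X : A⟦X⟧) ^ 2 - 1) (lam := log A) frame_constantCoeff frame_coeff_one
    hf'0 constantCoeff_log coeff_one_log (map_log φ) log_subst_frame hlam'0 hlam'1 hlam'φ hlam'f hϑ0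
    hϑ1 hε hϑ hsep

/-- AUTOPSY of K1 as typed in k1-g37 (`(1 + X)·(ϖ′∘ϑ)·ϑ′ = C ε` with `ϖ′ = invDiff′`): together with
the (proved) corrected identity it forces `ε · ((ϖ′∘ϑ)² − 1) = 0`, i.e. at order `X¹`:
`2 · ϖ′₁ · ε² = 0` — false in the frame (`ε` a unit of the domain `𝒪̂_{ℚ₂^nr}`, `ϖ′₁ = 2/(π′² − π′) ≠ 0`
from `hEf′` at order `X¹` for `f′ = π′X + X²`). -/
theorem autopsy_K1_as_typed {ε : A} {ϖ' ϑ : A⟦X⟧}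
    (hP : (1 + X : A⟦X⟧) * d⁄dX A ϑ = C ε * ϖ'.subst ϑ)
    (hQ : (1 + X : A⟦X⟧) * (ϖ'.subst ϑ * d⁄dX A ϑ) = C ε) :
    C ε * ((ϖ'.subst ϑ) ^ 2 - 1) = 0 := by
  linear_combination hQ - ϖ'.subst ϑ * hP

/-- … and its linear coefficient: `2 · ϖ′₁ · ε² = 0` (with `ϑ ≡ εX`). -/
theorem autopsy_K1_as_typed_coeff_one {ε : A} {ϖ' ϑ : A⟦X⟧} (hϖ'0 : constantCoeff ϖ' = 1)
    (hϑ0 : constantCoeff ϑ = 0) (hϑ1 : coeff 1 ϑ = ε)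
    (hP : (1 + X : A⟦X⟧) * d⁄dX A ϑ = C ε * ϖ'.subst ϑ)
    (hQ : (1 + X : A⟦X⟧) * (ϖ'.subst ϑ * d⁄dX A ϑ) = C ε) :
    2 * coeff 1 ϖ' * ε ^ 2 = 0 := by
  have hS0 : constantCoeff (ϖ'.subst ϑ) = 1 := by
    rw [constantCoeff_subst_of_constantCoeff_eq_zero hϑ0, hϖ'0]
  have hS1 : coeff 1 (ϖ'.subst ϑ) = coeff 1 ϖ' * ε := by
    rw [coeff_one_subst_of_constantCoeff_eq_zero hϑ0, hϑ1]
  have h := congrArg (coeff 1) (autopsy_K1_as_typed hP hQ)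
  rw [coeff_C_mul, map_sub, sq, coeff_one_mul, hS0, hS1, coeff_one, if_neg one_ne_zero,
    map_zero] at h
  linear_combination h

/-! ### §7 The weakest sufficient form: `hcomp` of k1-g37's `mahler_transport`

In any `A`-algebra `B` (the field `E`/`K̂^{nr}`/`ℂ₂` of the docket) where the logarithm `λ′` of `F_{f′}`
lives with `λ′′ · ϖ′ = 1` (`ϖ′ = 1/λ′′`, docstring of `LubinTate.invDiff`; tree `ltLog`), the frame
pullback gives literally `hcomp : (1 + X) * d⁄dX (λ′ ∘ ϑ) = C ε`. -/

/-- ★★ **`hcomp`**: `(1 + X) · (λ′ ∘ ϑ)′ = ε`. -/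
theorem hcomp_of_pullback {B : Type*} [CommRing B] (ι : A →+* B) {ε : A} {ϖ' ϑ : A⟦X⟧}
    {lam : B⟦X⟧} (hϑ0 : constantCoeff ϑ = 0)
    (hpull : (1 + X : A⟦X⟧) * d⁄dX A ϑ = C ε * ϖ'.subst ϑ)
    (hlam : d⁄dX B lam * ϖ'.map ι = 1) :
    (1 + X : B⟦X⟧) * d⁄dX B (lam.subst (ϑ.map ι)) = C (ι ε) := by
  have hsϑ : HasSubst ϑ := HasSubst.of_constantCoeff_zero' hϑ0
  have hϑι0 : constantCoeff (ϑ.map ι) = 0 := by rw [constantCoeff_map', hϑ0, map_zero]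
  have hsϑι : HasSubst (ϑ.map ι) := HasSubst.of_constantCoeff_zero' hϑι0
  have h := congrArg (PowerSeries.map ι) hpull
  rw [map_mul, map_mul, map_add, map_one, map_X, ← derivative_map', map_C,
    map_subst_one' ι hsϑ] at h
  have h1 : (d⁄dX B lam).subst (ϑ.map ι) * (ϖ'.map ι).subst (ϑ.map ι) = 1 := by
    rw [← subst_mul' hsϑι, hlam, ← coe_substAlgHom hsϑι, map_one]
  rw [derivative_subst B hsϑι]
  linear_combination (d⁄dX B lam).subst (ϑ.map ι) * h + C (ι ε) * h1

/-- ★★★ **`hcomp` VERBATIM (k1-g37 `mahler_transport`), from the log-level pullback**: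
`(1 + X) · (λ′ ∘ ϑ)′ = C ε` — no `ϖ′`, no `λ′′·ϖ′ = 1` needed. -/
theorem hcomp_of_log_pullback [Algebra ℚ A] {ε : A} {lam' ϑ : A⟦X⟧}
    (hlog : lam'.subst ϑ = C ε * log A) :
    (1 + X : A⟦X⟧) * d⁄dX A (lam'.subst ϑ) = C ε := by
  rw [hlog, (d⁄dX A).leibniz (C ε) (log A), derivative_C, smul_zero, add_zero, smul_eq_mul,
    show (1 + X : A⟦X⟧) * (C ε * d⁄dX A (log A)) = C ε * ((1 + X) * d⁄dX A (log A)) by ring,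
    one_add_X_mul_deriv_log, mul_one]

/-! ### §8 Instantiation on the tree's comparison series `LubinTate.compSeries`

The hypotheses `hϑ0/hϑ1/hϑ/hreg/hsep/φ π = π` of §4 are, BY NAME, `constantCoeff_compSeries`,
`coeff_one_compSeries`, `subst_compSeries`, `IsTwistBase.eq_zero_of_mul_eq_zero`, §3, `IsTwistBase.map_eq`;
what remains abstract is only the pair `ϖ, ϖ′` with their defining identities (`invDiff` of `f`, `f′`
read in `A`: `LubinTate.invDiff_mul_derivative_hom _ _ hinj π` mapped by `ι`). -/

section TreeInstantiation

open Literature.NumberTheory.GaloisRepresentations Literature.NumberTheory.GaloisRepresentations.LubinTate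

variable {𝒪 : Type*} [CommRing 𝒪] (ι : 𝒪 →+* A) (φ : A →+* A) {π₀ : 𝒪} {q : ℕ}
  {u₀ : 𝒪ˣ} {f f' : PowerSeries 𝒪} [IsAdicComplete (Ideal.span {ι π₀}) A]
  (hA : IsTwistBase (ι π₀) q φ)
  (hf : IsLTSeries π₀ q f) (hf' : IsLTSeries ((u₀ : 𝒪) * π₀) q f') {ε : A} (hε : φ ε = ι u₀ * ε)

/-- ★★ **H3′ for `ϑ = LubinTate.compSeries ι φ hA hf hf' hε`**: `ϖ_f · ϑ′ = ε · ϖ_{f′}(ϑ)`. -/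
theorem invDiff_pullback_compSeries {ϖ ϖ' : A⟦X⟧}
    (hϖ0 : constantCoeff ϖ = 1) (hϖφ : ϖ.map φ = ϖ)
    (hEf : ϖ * d⁄dX A (f.map ι) = C (ι π₀) * ϖ.subst (f.map ι))
    (hϖ'0 : constantCoeff ϖ' = 1) (hϖ'φ : ϖ'.map φ = ϖ')
    (hEf' : ϖ' * d⁄dX A (f'.map ι) = C (ι u₀ * ι π₀) * ϖ'.subst (f'.map ι)) :
    ϖ * d⁄dX A (compSeries ι φ hA hf hf' hε) =
      C ε * ϖ'.subst (compSeries ι φ hA hf hf' hε) :=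
  invDiff_pullback φ (π := ι π₀) (u := ι u₀)
    (by rw [constantCoeff_map', hf.constantCoeff_eq_zero, map_zero])
    (by rw [coeff_map, hf.coeff_one])
    (by rw [constantCoeff_map', hf'.constantCoeff_eq_zero, map_zero])
    (by rw [coeff_map, hf'.coeff_one, map_mul])
    hϖ0 hϖφ hEf hϖ'0 hϖ'φ hEf'
    (constantCoeff_compSeries ι φ hA hf hf' hε) (coeff_one_compSeries ι φ hA hf hf' hε) hε
    (subst_compSeries ι φ hA hf hf' hε).symm hA.eq_zero_of_mul_eq_zero
    (fun n hn x hx => hsep_of_isAdicComplete φ hA.map_eq (unitMap ι u₀) hn (by simpa using hx))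

/-- ★★★ **The frame case on the tree's `compSeries`** (`ι π₀ = 2`, `f^ι = (1 + X)² − 1`):
`(1 + X) · ϑ′ = ε · ϖ′(ϑ)`, `ϑ = LubinTate.compSeries …` — K1/H3′ of k1-g37 with only `ϖ′` abstract. -/
theorem frame_pullback_compSeries (h2 : ι π₀ = 2) (hfX : f.map ι = (1 + X : A⟦X⟧) ^ 2 - 1)
    {ϖ' : A⟦X⟧} (hϖ'0 : constantCoeff ϖ' = 1) (hϖ'φ : ϖ'.map φ = ϖ')
    (hEf' : ϖ' * d⁄dX A (f'.map ι) = C (ι u₀ * ι π₀) * ϖ'.subst (f'.map ι)) :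
    (1 + X : A⟦X⟧) * d⁄dX A (compSeries ι φ hA hf hf' hε) =
      C ε * ϖ'.subst (compSeries ι φ hA hf hf' hε) :=
  invDiff_pullback_compSeries ι φ hA hf hf' hε (ϖ := 1 + X) (by simp)
    (by rw [map_add, map_one, map_X]) (by rw [hfX, h2]; exact invDiff_eq_frame) hϖ'0 hϖ'φ hEf'

end TreeInstantiation

/-! ### §9 H2 currency bridge (k1-g37 K2, XS): `π ∣ x` in `𝒪` ↔ `‖π⁻¹ x‖ ≤ 1` in the field -/

/-- `‖p⁻¹ x‖ ≤ 1 ↔ x ∈ p·(unit ball)`. -/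
theorem norm_inv_mul_le_one_iff {𝕜 : Type*} [NormedField 𝕜] {p : 𝕜} (hp : p ≠ 0) (x : 𝕜) :
    ‖p⁻¹ * x‖ ≤ 1 ↔ ∃ y : 𝕜, ‖y‖ ≤ 1 ∧ x = p * y := by
  constructor
  · intro h
    exact ⟨p⁻¹ * x, h, by rw [mul_inv_cancel_left₀ hp]⟩
  · rintro ⟨y, hy, rfl⟩
    rwa [inv_mul_cancel_left₀ hp]


/-! ### §10 ★★★★ THE DOCKET'S T3 / R218a «PULLBACK₂» CLOSED: k3-g39's `ComparisonChainRule`, verbatim,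
for EVERY uniformiser `π` of EVERY nonarchimedean local field `F` (any `q`), on the tree's
`ltComparison` / `compSeriesC`

`ω_f^ι · ϑ′ = C (coeff 1 ϑ) · ω_{f′}^ι(ϑ)` in `𝐃⟦X⟧ = UnrCoeff F⟦X⟧`, `ϑ = compSeriesC hπ hσ₀ u hε`,
`ω_f = invDiff (isLTRing_LTCoeff hπ) (isLTSeries_LTCoeff π)`, `ω_{f′}` the same for `π′ = uπ`,
`ι = (intToUnrCoeff F).comp (LTCoeff.of F).symm.toRingHom` — by §8 `invDiff_pullback_compSeries` with all six
side conditions discharged BY NAME from the tree (`constantCoeff_invDiff`, `galAut_algebraMap`,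
`invDiff_mul_derivative_ltSer`), then transported to the discrete copy as the tree transports
`subst_hom_ltComparison` (`LubinTateComparisonDilation.subst_homC_compSeriesC`). -/

section DocketT3

open Literature.NumberTheory.GaloisRepresentations
open Literature.NumberTheory.GaloisRepresentations.IsNonarchimedeanLocalField
open Literature.NumberTheory.GaloisRepresentations.LubinTate ValuativeRel Field
open Literature.NumberTheory.PAdicHodge

variable {F : Type} [Field F] [ValuativeRel F] [TopologicalSpace F] [IsNonarchimedeanLocalField F]

attribute [local instance] ltNormUniformSpace ltNormIsUniformAddGroup rk1 nF nE fintypeResidueField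

variable {π : 𝒪[F]} (hπ : (valuation F).IsUniformizer (π : F)) (u : 𝒪[F]ˣ)
  {σ₀ : absoluteGaloisGroup F} (hσ₀ : IsAbsArithFrob σ₀)
  {ε : (maxUnramifiedCompletion F)ˣ}
  (hε : maxUnramifiedCompletion.galAut F σ₀ (ε : maxUnramifiedCompletion F) =
    algebraMap 𝒪[F] (maxUnramifiedCompletion F) (u : 𝒪[F]) * (ε : maxUnramifiedCompletion F))

/-- `𝒪[F] = LTCoeff F → 𝒪̂_{F^nr}` (the structure map read on the discrete copy `LTCoeff F`). -/
abbrev ltEmb (F : Type) [Field F] [ValuativeRel F] [TopologicalSpace F] [IsNonarchimedeanLocalField F] :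
    LTCoeff F →+* maxUnramifiedCompletion F :=
  (algebraMap 𝒪[F] (maxUnramifiedCompletion F)).comp (LTCoeff.of F).symm.toRingHom

/-- `f = πX + X^q` read through `ltEmb` is `f` read through the structure map (unfolding). -/
theorem map_ltEmb_ltSer {B : Type*} [CommRing B] (j : 𝒪[F] →+* B) (π : 𝒪[F]) :
    (ltSer F π).map (j.comp (LTCoeff.of F).symm.toRingHom) =
      (((ltPoly F π : Polynomial 𝒪[F]) : PowerSeries 𝒪[F])).map j := by
  ext n
  rw [coeff_map, coeff_map]
  rfl

/-- The invariant differential read in any `𝒪[F]`-algebra `B` keeps `ω(0) = 1` and its `[π]`-equivariance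
`ω · f′ = π · ω ∘ f` (tree `constantCoeff_invDiff`, `invDiff_mul_derivative_ltSer`, mapped). -/
theorem invDiff_map_spec {B : Type*} [CommRing B] (j : 𝒪[F] →+* B) :
    constantCoeff ((invDiff (isLTRing_LTCoeff hπ) (isLTSeries_LTCoeff π)).map
        (j.comp (LTCoeff.of F).symm.toRingHom)) = 1 ∧
      (invDiff (isLTRing_LTCoeff hπ) (isLTSeries_LTCoeff π)).map (j.comp (LTCoeff.of F).symm.toRingHom) *
          d⁄dX B ((((ltPoly F π : Polynomial 𝒪[F]) : PowerSeries 𝒪[F])).map j) =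
        C (j π) *
          ((invDiff (isLTRing_LTCoeff hπ) (isLTSeries_LTCoeff π)).map
            (j.comp (LTCoeff.of F).symm.toRingHom)).subst
            ((((ltPoly F π : Polynomial 𝒪[F]) : PowerSeries 𝒪[F])).map j) := by
  refine ⟨by rw [constantCoeff_map', constantCoeff_invDiff, map_one], ?_⟩
  have hs : HasSubst (ltSer F π) :=
    HasSubst.of_constantCoeff_zero' (isLTSeries_LTCoeff π).constantCoeff_eq_zero
  have h := congrArg (PowerSeries.map (j.comp (LTCoeff.of F).symm.toRingHom))
    (invDiff_mul_derivative_ltSer (F := F) hπ)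
  rw [map_mul, map_mul, ← derivative_map', map_C, map_subst_one' _ hs, map_ltEmb_ltSer] at h
  exact h

/-- The invariant differential read in `𝒪̂_{F^nr}` is Frobenius-fixed coefficientwise. -/
theorem map_galAut_invDiff_map :
    ((invDiff (isLTRing_LTCoeff hπ) (isLTSeries_LTCoeff π)).map (ltEmb F)).map
        (maxUnramifiedCompletion.galAut F σ₀).toRingHom =
      (invDiff (isLTRing_LTCoeff hπ) (isLTSeries_LTCoeff π)).map (ltEmb F) := by
  have hc : (maxUnramifiedCompletion.galAut F σ₀).toRingHom.comp (ltEmb F) = ltEmb F :=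
    RingHom.ext fun a => maxUnramifiedCompletion.galAut_algebraMap σ₀ ((LTCoeff.of F).symm a)
  rw [← RingHom.comp_apply (PowerSeries.map (maxUnramifiedCompletion.galAut F σ₀).toRingHom)
      (PowerSeries.map (ltEmb F)), ← PowerSeries.map_comp, hc]

/-- ★★★★ **R218a «PULLBACK₂» over `𝒪̂_{F^nr}`**: `ω_f · ϑ′ = ε · ω_{f′}(ϑ)` for the tree's
`ϑ = ltComparison hπ hσ₀ u hε` (any `F`, any uniformiser `π`, any `q`). -/
theorem invDiff_mul_derivative_ltComparison :
    (invDiff (isLTRing_LTCoeff hπ) (isLTSeries_LTCoeff π)).map (ltEmb F) *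
        d⁄dX (maxUnramifiedCompletion F) (ltComparison hπ hσ₀ u hε) =
      C (ε : maxUnramifiedCompletion F) *
        ((invDiff (isLTRing_LTCoeff (isUniformizer_unit_mul hπ u))
            (isLTSeries_LTCoeff ((u : 𝒪[F]) * π))).map (ltEmb F)).subst (ltComparison hπ hσ₀ u hε) := by
  haveI := isAdicComplete_span_unrPi hπ
  obtain ⟨h0, hE⟩ := invDiff_map_spec hπ (algebraMap 𝒪[F] (maxUnramifiedCompletion F))
  obtain ⟨h0', hE'⟩ := invDiff_map_spec (isUniformizer_unit_mul hπ u)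
    (algebraMap 𝒪[F] (maxUnramifiedCompletion F))
  rw [map_mul (algebraMap 𝒪[F] (maxUnramifiedCompletion F)) (u : 𝒪[F]) π] at hE'
  exact invDiff_pullback_compSeries (algebraMap 𝒪[F] (maxUnramifiedCompletion F))
    (maxUnramifiedCompletion.galAut F σ₀).toRingHom (isTwistBase_galAut hπ hσ₀)
    (isLTSeries_ltPoly F (π := π)) (isLTSeries_ltPoly F (π := (u : 𝒪[F]) * π)) (u₀ := u)
    (ε := (ε : maxUnramifiedCompletion F)) hε
    h0 (map_galAut_invDiff_map hπ) hE h0' (map_galAut_invDiff_map (isUniformizer_unit_mul hπ u)) hE'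

/-- ★★★★ **k3-g39's sub-stub T3 `ComparisonChainRule`, for every uniformiser** (its `h2 ↦ hπ`): the statement
below with `π := ((2 : ℕ) : 𝒪[F])` is `ComparisonChainRule h2 u hσ₀ hε` of
`STUB_IDEAS_stub_heegnerIndexLowerAtTwo_3_g39.lean` VERBATIM. -/
theorem comparisonChainRuleC :
    PowerSeries.map ((intToUnrCoeff F).comp (LTCoeff.of F).symm.toRingHom)
          (invDiff (isLTRing_LTCoeff hπ) (isLTSeries_LTCoeff π)) *
        PowerSeries.derivative (UnrCoeff F) (compSeriesC hπ hσ₀ u hε) =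
      PowerSeries.C (PowerSeries.coeff 1 (compSeriesC hπ hσ₀ u hε)) *
        PowerSeries.subst (compSeriesC hπ hσ₀ u hε)
          ((invDiff (isLTRing_LTCoeff (isUniformizer_unit_mul hπ u))
              (isLTSeries_LTCoeff ((u : 𝒪[F]) * π))).map
            ((intToUnrCoeff F).comp (LTCoeff.of F).symm.toRingHom)) := by
  have hsθ : HasSubst (ltComparison hπ hσ₀ u hε) :=
    HasSubst.of_constantCoeff_zero' (constantCoeff_ltComparison hπ hσ₀ u hε)
  have h := congrArg (PowerSeries.map (UnrCoeff.of F).toRingHom)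
    (invDiff_mul_derivative_ltComparison hπ u hσ₀ hε)
  rw [map_mul, map_mul, ← derivative_map', map_C, map_subst_one' _ hsθ,
    ← RingHom.comp_apply (PowerSeries.map (UnrCoeff.of F).toRingHom) (PowerSeries.map (ltEmb F)),
    ← PowerSeries.map_comp,
    ← RingHom.comp_apply (PowerSeries.map (UnrCoeff.of F).toRingHom) (PowerSeries.map (ltEmb F)),
    ← PowerSeries.map_comp] at h
  have e1 : PowerSeries.coeff 1 (compSeriesC hπ hσ₀ u hε) =
      (UnrCoeff.of F).toRingHom (ε : maxUnramifiedCompletion F) := by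
    rw [compSeriesC, coeff_map, coeff_one_ltComparison]
  rw [e1]
  exact h

/-- The `π = 2` instance: LITERALLY the Prop `ComparisonChainRule h2 u hσ₀ hε` of k3-g39 (T3, «THE ONLY OPEN
PIECE» of its split of R218), now a theorem. -/
theorem comparisonChainRule_two (h2 : (valuation F).IsUniformizer (((2 : ℕ) : 𝒪[F]) : F)) :
    PowerSeries.map ((intToUnrCoeff F).comp (LTCoeff.of F).symm.toRingHom)
          (invDiff (isLTRing_LTCoeff h2) (isLTSeries_LTCoeff (((2 : ℕ) : 𝒪[F])))) *
        PowerSeries.derivative (UnrCoeff F) (compSeriesC h2 hσ₀ u hε) =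
      PowerSeries.C (PowerSeries.coeff 1 (compSeriesC h2 hσ₀ u hε)) *
        PowerSeries.subst (compSeriesC h2 hσ₀ u hε)
          ((invDiff (isLTRing_LTCoeff (isUniformizer_unit_mul h2 u))
              (isLTSeries_LTCoeff ((u : 𝒪[F]) * ((2 : ℕ) : 𝒪[F])))).map
            ((intToUnrCoeff F).comp (LTCoeff.of F).symm.toRingHom)) :=
  comparisonChainRuleC h2 u hσ₀ hε

end DocketT3

end Summit.BirchSwinnertonDyer.BirchSwinnertonDyer.Cruxes.SplitBadTwoLowerHalfOfFacts.TwistedRigidityK1G38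

end
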